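import Mathlib.Analysis.Calculus.FDeriv.Symmetric
import Mathlib.Analysis.Calculus.ContDiff.Bounds
import Mathlib.Analysis.Calculus.Deriv.Pi
import Mathlib.Analysis.Calculus.FDeriv.CompCLM
import Literature.NumberTheory.Sieve.KloostermanQuintilinearSmooth
import HarnessLib

/-!
# Calculus of the fixed-order mixed partial derivative `KloostermanQuintilinear.mixedDeriv`

Topic `Literature/NumberTheory/Sieve`.  The Deshouillers–Iwaniec / Drappeau / Assing–Blomer–Li
bounds for quintilinear sums of Kloosterman fractions (`KloostermanQuintilinearCongruences.lean`,
`KloostermanTrilinearBoundDI11.lean`, …) are stated in the tree with hypotheses on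
`KloostermanQuintilinear.mixedDeriv ν g`, the NESTED one-variable iterated derivative
`∂_c^{ν₀}(∂_d^{ν₁}(∂_n^{ν₂}(∂_r^{ν₃}(∂_s^{ν₄} g))))` of a five-variable weight.  To verify such
hypotheses for weights that are NOT separable (as in the Poisson-summation step of Drappeau 2017,
§4.3.3, where `g(c, θvsc, n, r, s)` occurs) one needs the bridge between this nested derivative and
the Fréchet calculus of Mathlib (`iteratedFDeriv`), for which the chain rule (`norm_iteratedFDeriv_comp_le`)
and the Leibniz rule (`norm_iteratedFDeriv_mul_le`) are available.  This file provides that bridge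
for smooth `g` (everything PROVED, no named fact, standard axioms):

* `pd i H` — the partial derivative `x ↦ fderiv ℝ H x eᵢ` of `H : (Fin 5 → ℝ) → ℂ`, and
  `wordDeriv w H = ∂_{w₀} ∂_{w₁} ⋯ H` for a word `w : List (Fin 5)`;
* `pd_comm` (Clairaut–Schwarz, from `ContDiffAt.isSymmSndFDerivAt`) and `wordDeriv_perm`:
  for smooth `H` the word derivative only depends on the multiset of the word;
* `iteratedFDeriv_apply_e5` : `iteratedFDeriv ℝ n H x (e_{w 0}, …, e_{w (n-1)}) = wordDeriv w H x`;
* `norm_iteratedFDeriv_le_of_wordDeriv` : `‖iteratedFDeriv ℝ n H x‖ ≤ 5ⁿ B` when all words of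
  length `n` are bounded by `B` at `x` (sup norm on `Fin 5 → ℝ`);
* `mixedDeriv_eq_wordDeriv` : `mixedDeriv ν g (c,d,n,r,s) = wordDeriv (sortedWord ν) (U5 g) ![c,d,n,r,s]`
  and `norm_mixedDeriv_le_norm_iteratedFDeriv`;
* `wordDeriv_comp_scale5` (diagonal rescaling) and `wordDeriv_eq_zero_of_eventuallyEq` (locality).

## References

* [folklore] H. A. Schwarz's theorem on mixed partials; multilinear expansion in a basis.
* S. Drappeau, Proc. LMS (3) 114 (2017) 684–732, §4.3.3 (where the bridge is used).
  [cite: Drappeau2017, §4.3.3]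
-/

noncomputable section

open scoped ContDiff BigOperators
open Function Filter Topology

namespace Literature.NumberTheory.Sieve

namespace KloostermanQuintilinear

/-! ### Vocabulary -/

/-- `ℝ⁵` as `Fin 5 → ℝ` (sup norm). [folklore] -/
abbrev R5 : Type := Fin 5 → ℝ

/-- The coordinate vector `eᵢ`. [folklore] -/
def e5 (i : Fin 5) : R5 := Pi.single i 1

/-- `eᵢ i = 1`. [folklore] -/
@[simp] theorem e5_apply_same (i : Fin 5) : e5 i i = 1 := by simp [e5]

/-- `eᵢ j = δᵢⱼ`. [folklore] -/
theorem e5_apply (i j : Fin 5) : e5 i j = if j = i then 1 else 0 := by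
  simp [e5, Pi.single_apply]

/-- `‖eᵢ‖ = 1` (sup norm). [folklore] -/
@[simp] theorem norm_e5 (i : Fin 5) : ‖e5 i‖ = 1 := by
  rw [e5, Pi.norm_single, norm_one]

/-- Uncurrying a five-variable weight, with the tree's convention
`fun p : Fin 5 → ℝ => g (p 0) (p 1) (p 2) (p 3) (p 4)`. [folklore] -/
def U5 (g : ℝ → ℝ → ℝ → ℝ → ℝ → ℂ) : R5 → ℂ := fun p => g (p 0) (p 1) (p 2) (p 3) (p 4)

/-- Unfolding `U5`. [folklore] -/
theorem U5_apply (g : ℝ → ℝ → ℝ → ℝ → ℝ → ℂ) (p : R5) :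
    U5 g p = g (p 0) (p 1) (p 2) (p 3) (p 4) := rfl

/-- The partial derivative of `H : ℝ⁵ → ℂ` in the direction `eᵢ`. [folklore] -/
def pd (i : Fin 5) (H : R5 → ℂ) : R5 → ℂ := fun x => fderiv ℝ H x (e5 i)

/-- Unfolding `pd`. [folklore] -/
theorem pd_apply (i : Fin 5) (H : R5 → ℂ) (x : R5) : pd i H x = fderiv ℝ H x (e5 i) := rfl

/-- The word derivative `∂_{w₀} ∂_{w₁} ⋯ ∂_{w_{k-1}} H` (leftmost letter outermost). [folklore] -/
def wordDeriv : List (Fin 5) → (R5 → ℂ) → (R5 → ℂ)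
  | [], H => H
  | i :: w, H => pd i (wordDeriv w H)

/-- The empty word does nothing. [folklore] -/
@[simp] theorem wordDeriv_nil (H : R5 → ℂ) : wordDeriv [] H = H := rfl

/-- `∂_{i w} = ∂ᵢ ∂_w`. [folklore] -/
@[simp] theorem wordDeriv_cons (i : Fin 5) (w : List (Fin 5)) (H : R5 → ℂ) :
    wordDeriv (i :: w) H = pd i (wordDeriv w H) := rfl

/-- `∂_{w w'} = ∂_w ∂_{w'}`. [folklore] -/
theorem wordDeriv_append (w w' : List (Fin 5)) (H : R5 → ℂ) :
    wordDeriv (w ++ w') H = wordDeriv w (wordDeriv w' H) := by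
  induction w with
  | nil => rfl
  | cons i w ih => simp [ih]

/-- `∂_{iᵏ} = ∂ᵢᵏ`. [folklore] -/
theorem wordDeriv_replicate (k : ℕ) (i : Fin 5) (H : R5 → ℂ) :
    wordDeriv (List.replicate k i) H = (pd i)^[k] H := by
  induction k with
  | zero => rfl
  | succ k ih => rw [List.replicate_succ, wordDeriv_cons, ih, iterate_succ_apply']

/-- The sorted word `0^{ν 0} 1^{ν 1} 2^{ν 2} 3^{ν 3} 4^{ν 4}` of a multi-index. [folklore] -/
def sortedWord (ν : Fin 5 → ℕ) : List (Fin 5) :=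
  List.replicate (ν 0) 0 ++ List.replicate (ν 1) 1 ++ List.replicate (ν 2) 2 ++
    List.replicate (ν 3) 3 ++ List.replicate (ν 4) 4

/-- The sorted word has length `|ν|`. [folklore] -/
theorem length_sortedWord (ν : Fin 5 → ℕ) :
    (sortedWord ν).length = ν 0 + ν 1 + ν 2 + ν 3 + ν 4 := by
  simp [sortedWord]; ring

/-- The letter `i` occurs `ν i` times in the sorted word. [folklore] -/
theorem count_sortedWord (ν : Fin 5 → ℕ) (i : Fin 5) : (sortedWord ν).count i = ν i := by
  fin_cases i <;> simp [sortedWord, List.count_replicate]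

/-- Every word is a permutation of the sorted word of its letter counts. [folklore] -/
theorem perm_sortedWord_count (w : List (Fin 5)) : w.Perm (sortedWord fun i => w.count i) := by
  rw [List.perm_iff_count]
  intro i
  rw [count_sortedWord]

/-! ### Smoothness is preserved -/

/-- Partial derivatives of smooth functions are smooth. [folklore] -/
theorem contDiff_pd {H : R5 → ℂ} (hH : ContDiff ℝ ∞ H) (i : Fin 5) : ContDiff ℝ ∞ (pd i H) := by
  have h1 : ContDiff ℝ ∞ (fderiv ℝ H) := (contDiff_infty_iff_fderiv.mp hH).2
  exact h1.clm_apply contDiff_const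

/-- Iterated partial derivatives of smooth functions are smooth. [folklore] -/
theorem contDiff_iterate_pd {H : R5 → ℂ} (hH : ContDiff ℝ ∞ H) (i : Fin 5) (k : ℕ) :
    ContDiff ℝ ∞ ((pd i)^[k] H) := by
  induction k with
  | zero => exact hH
  | succ k ih => rw [iterate_succ_apply']; exact contDiff_pd ih i

/-- Word derivatives of smooth functions are smooth. [folklore] -/
theorem contDiff_wordDeriv {H : R5 → ℂ} (hH : ContDiff ℝ ∞ H) (w : List (Fin 5)) :
    ContDiff ℝ ∞ (wordDeriv w H) := by
  induction w with
  | nil => exact hH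
  | cons i w ih => exact contDiff_pd ih i

/-! ### Clairaut–Schwarz and permutation invariance -/

/-- `∂ᵢ∂ⱼH = D²H(eᵢ)(eⱼ)`. [folklore] -/
theorem pd_pd_eq_fderiv_fderiv {H : R5 → ℂ} (hH : ContDiff ℝ ∞ H) (i j : Fin 5) (x : R5) :
    pd i (pd j H) x = fderiv ℝ (fderiv ℝ H) x (e5 i) (e5 j) := by
  have hd : DifferentiableAt ℝ (fderiv ℝ H) x :=
    ((contDiff_infty_iff_fderiv.mp hH).2.differentiable (by simp)).differentiableAt
  show fderiv ℝ (fun y => fderiv ℝ H y (e5 j)) x (e5 i) = _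
  rw [fderiv_clm_apply hd (differentiableAt_const _)]
  simp

/-- **Schwarz's theorem** for the partial derivatives of a smooth `H : ℝ⁵ → ℂ`. [folklore] -/
theorem pd_comm {H : R5 → ℂ} (hH : ContDiff ℝ ∞ H) (i j : Fin 5) :
    pd i (pd j H) = pd j (pd i H) := by
  funext x
  rw [pd_pd_eq_fderiv_fderiv hH, pd_pd_eq_fderiv_fderiv hH]
  have h2 : minSmoothness ℝ 2 ≤ ∞ := by
    rw [minSmoothness_of_isRCLikeNormedField]
    exact WithTop.coe_le_coe.2 le_top
  have hs : IsSymmSndFDerivAt ℝ H x := hH.contDiffAt.isSymmSndFDerivAt h2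
  exact hs (e5 i) (e5 j)

/-- For smooth `H` the word derivative depends only on the multiset of letters. [folklore] -/
theorem wordDeriv_perm {H : R5 → ℂ} (hH : ContDiff ℝ ∞ H) {w w' : List (Fin 5)}
    (h : w.Perm w') : wordDeriv w H = wordDeriv w' H := by
  induction h with
  | nil => rfl
  | cons i _ ih => rw [wordDeriv_cons, wordDeriv_cons, ih]
  | swap i j l => exact pd_comm (contDiff_wordDeriv hH l) j i
  | trans _ _ ih₁ ih₂ => exact ih₁.trans ih₂

/-- A word derivative equals the sorted word derivative of its letter counts. [folklore] -/
theorem wordDeriv_eq_wordDeriv_sortedWord {H : R5 → ℂ} (hH : ContDiff ℝ ∞ H) (w : List (Fin 5)) :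
    wordDeriv w H = wordDeriv (sortedWord fun i => w.count i) H :=
  wordDeriv_perm hH (perm_sortedWord_count w)

/-! ### The bridge to `iteratedFDeriv` -/

/-- `iteratedFDeriv ℝ n H x (e_{w 0}, …, e_{w (n-1)}) = (∂_{w 0} ⋯ ∂_{w (n-1)} H)(x)`. [folklore] -/
theorem iteratedFDeriv_apply_e5 {H : R5 → ℂ} (hH : ContDiff ℝ ∞ H) :
    ∀ (n : ℕ) (w : Fin n → Fin 5) (x : R5),
      iteratedFDeriv ℝ n H x (fun k => e5 (w k)) = wordDeriv (List.ofFn w) H x := by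
  intro n
  induction n with
  | zero => intro w x; simp
  | succ n ih =>
    intro w x
    rw [iteratedFDeriv_succ_apply_left, List.ofFn_succ, wordDeriv_cons, pd_apply]
    have hfun : wordDeriv (List.ofFn fun k : Fin n => w k.succ) H =
        fun y => iteratedFDeriv ℝ n H y (Fin.tail fun k => e5 (w k)) := by
      funext y
      rw [← ih (fun k => w k.succ) y]
      rfl
    rw [hfun, fderiv_continuousMultilinear_apply_const_apply]
    exact hH.differentiable_iteratedFDeriv (by exact_mod_cast ENat.coe_lt_top n) x

/-- List form of `iteratedFDeriv_apply_e5`. [folklore] -/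
theorem iteratedFDeriv_apply_e5_get {H : R5 → ℂ} (hH : ContDiff ℝ ∞ H) (w : List (Fin 5)) (x : R5) :
    iteratedFDeriv ℝ w.length H x (fun k => e5 (w.get k)) = wordDeriv w H x := by
  rw [iteratedFDeriv_apply_e5 hH]
  rw [List.ofFn_get]

/-- A word derivative is bounded by the operator norm of the Fréchet derivative of the same order.
[folklore] -/
theorem norm_wordDeriv_le_norm_iteratedFDeriv {H : R5 → ℂ} (hH : ContDiff ℝ ∞ H) (w : List (Fin 5))
    (x : R5) : ‖wordDeriv w H x‖ ≤ ‖iteratedFDeriv ℝ w.length H x‖ := by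
  rw [← iteratedFDeriv_apply_e5_get hH w x]
  refine (ContinuousMultilinearMap.le_opNorm _ _).trans ?_
  have : ∏ k : Fin w.length, ‖e5 (w.get k)‖ = 1 := by simp
  rw [this, mul_one]

/-- **Operator norm from words**: if every word derivative of length `n` is bounded by `B` at `x`,
then `‖iteratedFDeriv ℝ n H x‖ ≤ 5ⁿ B` (sup norm on `ℝ⁵`). [folklore] -/
theorem norm_iteratedFDeriv_le_of_wordDeriv {H : R5 → ℂ} (hH : ContDiff ℝ ∞ H) {n : ℕ} {x : R5}
    {B : ℝ} (hB : 0 ≤ B) (h : ∀ w : Fin n → Fin 5, ‖wordDeriv (List.ofFn w) H x‖ ≤ B) :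
    ‖iteratedFDeriv ℝ n H x‖ ≤ 5 ^ n * B := by
  refine ContinuousMultilinearMap.opNorm_le_bound (by positivity) fun m => ?_
  set A := iteratedFDeriv ℝ n H x with hA
  have hm : m = fun k => ∑ i : Fin 5, (m k i) • e5 i := by
    funext k; funext j
    simp [Finset.sum_apply, e5_apply]
  have hexp : A m = ∑ σ : Fin n → Fin 5, (∏ k, m k (σ k)) • A (fun k => e5 (σ k)) := by
    conv_lhs => rw [hm]
    rw [ContinuousMultilinearMap.map_sum A (fun k i => (m k i) • e5 i)]
    refine Finset.sum_congr rfl fun σ _ => ?_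
    rw [ContinuousMultilinearMap.map_smul_univ]
  rw [hexp]
  refine (norm_sum_le _ _).trans ?_
  have hterm : ∀ σ : Fin n → Fin 5,
      ‖(∏ k, m k (σ k)) • A (fun k => e5 (σ k))‖ ≤ (∏ k, ‖m k‖) * B := by
    intro σ
    rw [norm_smul, norm_prod]
    refine mul_le_mul ?_ ?_ (norm_nonneg _) (Finset.prod_nonneg fun k _ => norm_nonneg _)
    · exact Finset.prod_le_prod (fun k _ => norm_nonneg _) fun k _ => norm_le_pi_norm (m k) (σ k)
    · rw [hA, iteratedFDeriv_apply_e5 hH n σ x]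
      exact h σ
  refine (Finset.sum_le_sum fun σ _ => hterm σ).trans ?_
  rw [Finset.sum_const, Finset.card_univ, Fintype.card_fun, Fintype.card_fin, Fintype.card_fin,
    nsmul_eq_mul]
  push_cast
  ring_nf
  rfl

/-! ### Slices and the nested derivative `mixedDeriv` -/

/-- Derivative of a coordinate slice `t ↦ H(x with xᵢ := t)`. [folklore] -/
theorem hasDerivAt_slice {H : R5 → ℂ} (hH : ContDiff ℝ ∞ H) (x : R5) (i : Fin 5) (t : ℝ) :
    HasDerivAt (fun t => H (update x i t)) (pd i H (update x i t)) t := by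
  have h1 : HasFDerivAt H (fderiv ℝ H (update x i t)) (update x i t) :=
    ((contDiff_infty_iff_fderiv.mp hH).1 _).hasFDerivAt
  have h2 : HasDerivAt (update x i) (Pi.single i (1 : ℝ)) t := hasDerivAt_update x i t
  exact h1.comp_hasDerivAt t h2

/-- `deriv` of a coordinate slice is the slice of the partial derivative. [folklore] -/
theorem deriv_slice {H : R5 → ℂ} (hH : ContDiff ℝ ∞ H) (x : R5) (i : Fin 5) :
    deriv (fun t => H (update x i t)) = fun t => pd i H (update x i t) := by
  funext t
  exact (hasDerivAt_slice hH x i t).deriv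

/-- Iterated derivative of a coordinate slice = iterated partial derivative. [folklore] -/
theorem iteratedDeriv_slice {H : R5 → ℂ} (hH : ContDiff ℝ ∞ H) (x : R5) (i : Fin 5) (k : ℕ) :
    iteratedDeriv k (fun t => H (update x i t)) (x i) = ((pd i)^[k] H) x := by
  induction k generalizing H with
  | zero => simp
  | succ k ih =>
    rw [iteratedDeriv_succ', deriv_slice hH x i, iterate_succ_apply]
    have := ih (contDiff_pd hH i)
    -- the slice of `pd i H` at `x`
    have hsl : (fun t => pd i H (update x i t)) = fun t => (pd i H) (update x i t) := rfl
    rw [hsl, this]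

/-- Updating coordinate `0` of `![a,b,c,d,e]`. [folklore] -/
private theorem update_vec5_0 (a b c d e t : ℝ) :
    update (![a, b, c, d, e] : R5) 0 t = ![t, b, c, d, e] := by
  funext j; fin_cases j <;> simp
/-- Updating coordinate `1` of `![a,b,c,d,e]`. [folklore] -/
private theorem update_vec5_1 (a b c d e t : ℝ) :
    update (![a, b, c, d, e] : R5) 1 t = ![a, t, c, d, e] := by
  funext j; fin_cases j <;> simp
/-- Updating coordinate `2` of `![a,b,c,d,e]`. [folklore] -/
private theorem update_vec5_2 (a b c d e t : ℝ) :
    update (![a, b, c, d, e] : R5) 2 t = ![a, b, t, d, e] := by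
  funext j; fin_cases j <;> simp
/-- Updating coordinate `3` of `![a,b,c,d,e]`. [folklore] -/
private theorem update_vec5_3 (a b c d e t : ℝ) :
    update (![a, b, c, d, e] : R5) 3 t = ![a, b, c, t, e] := by
  funext j; fin_cases j <;> simp
/-- Updating coordinate `4` of `![a,b,c,d,e]`. [folklore] -/
private theorem update_vec5_4 (a b c d e t : ℝ) :
    update (![a, b, c, d, e] : R5) 4 t = ![a, b, c, d, t] := by
  funext j; fin_cases j <;> simp

/-- **The nested derivative through partials**:
`mixedDeriv ν g (c,d,n,r,s) = (∂₀^{ν0} ∂₁^{ν1} ∂₂^{ν2} ∂₃^{ν3} ∂₄^{ν4} (U5 g)) (c,d,n,r,s)` for smooth `g`.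
[folklore] -/
theorem mixedDeriv_eq_iterate_pd (g : ℝ → ℝ → ℝ → ℝ → ℝ → ℂ) (hg : ContDiff ℝ ∞ (U5 g))
    (ν : Fin 5 → ℕ) (c d n r s : ℝ) :
    mixedDeriv ν g c d n r s =
      ((pd 0)^[ν 0] ((pd 1)^[ν 1] ((pd 2)^[ν 2] ((pd 3)^[ν 3] ((pd 4)^[ν 4] (U5 g))))))
        ![c, d, n, r, s] := by
  set H4 := (pd 4)^[ν 4] (U5 g) with hH4
  set H3 := (pd 3)^[ν 3] H4 with hH3
  set H2 := (pd 2)^[ν 2] H3 with hH2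
  set H1 := (pd 1)^[ν 1] H2 with hH1
  have s4 : ContDiff ℝ ∞ H4 := contDiff_iterate_pd hg 4 _
  have s3 : ContDiff ℝ ∞ H3 := contDiff_iterate_pd s4 3 _
  have s2 : ContDiff ℝ ∞ H2 := contDiff_iterate_pd s3 2 _
  have s1 : ContDiff ℝ ∞ H1 := contDiff_iterate_pd s2 1 _
  -- innermost variable `s`
  have e4 : ∀ c' d' n' r' : ℝ, iteratedDeriv (ν 4) (fun s' => g c' d' n' r' s') s =
      H4 ![c', d', n', r', s] := by
    intro c' d' n' r'
    have hf : (fun s' => g c' d' n' r' s') = fun t => U5 g (update ![c', d', n', r', s] 4 t) := by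
      funext t; simp [U5]
    have := iteratedDeriv_slice hg ![c', d', n', r', s] 4 (ν 4)
    simp only [Matrix.cons_val] at this
    rw [hf, this]
  have e3 : ∀ c' d' n' : ℝ, iteratedDeriv (ν 3) (fun r' => H4 ![c', d', n', r', s]) r =
      H3 ![c', d', n', r, s] := by
    intro c' d' n'
    have hf : (fun r' => H4 ![c', d', n', r', s]) = fun t => H4 (update ![c', d', n', r, s] 3 t) := by
      funext t; rw [update_vec5_3]
    have := iteratedDeriv_slice s4 ![c', d', n', r, s] 3 (ν 3)
    simp only [Matrix.cons_val] at this
    rw [hf, this]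
  have e2 : ∀ c' d' : ℝ, iteratedDeriv (ν 2) (fun n' => H3 ![c', d', n', r, s]) n =
      H2 ![c', d', n, r, s] := by
    intro c' d'
    have hf : (fun n' => H3 ![c', d', n', r, s]) = fun t => H3 (update ![c', d', n, r, s] 2 t) := by
      funext t; rw [update_vec5_2]
    have := iteratedDeriv_slice s3 ![c', d', n, r, s] 2 (ν 2)
    simp only [Matrix.cons_val] at this
    rw [hf, this]
  have e1 : ∀ c' : ℝ, iteratedDeriv (ν 1) (fun d' => H2 ![c', d', n, r, s]) d =
      H1 ![c', d, n, r, s] := by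
    intro c'
    have hf : (fun d' => H2 ![c', d', n, r, s]) = fun t => H2 (update ![c', d, n, r, s] 1 t) := by
      funext t; rw [update_vec5_1]
    have := iteratedDeriv_slice s2 ![c', d, n, r, s] 1 (ν 1)
    simp only [Matrix.cons_val] at this
    rw [hf, this]
  have e0 : iteratedDeriv (ν 0) (fun c' => H1 ![c', d, n, r, s]) c =
      ((pd 0)^[ν 0] H1) ![c, d, n, r, s] := by
    have hf : (fun c' => H1 ![c', d, n, r, s]) = fun t => H1 (update ![c, d, n, r, s] 0 t) := by
      funext t; rw [update_vec5_0]
    have := iteratedDeriv_slice s1 ![c, d, n, r, s] 0 (ν 0)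
    simp only [Matrix.cons_val] at this
    rw [hf, this]
  unfold mixedDeriv
  simp_rw [e4, e3, e2, e1]
  rw [e0]

/-- `mixedDeriv ν g = wordDeriv (sortedWord ν) (U5 g)` for smooth `g`. [folklore] -/
theorem mixedDeriv_eq_wordDeriv (g : ℝ → ℝ → ℝ → ℝ → ℝ → ℂ) (hg : ContDiff ℝ ∞ (U5 g))
    (ν : Fin 5 → ℕ) (c d n r s : ℝ) :
    mixedDeriv ν g c d n r s = wordDeriv (sortedWord ν) (U5 g) ![c, d, n, r, s] := by
  rw [mixedDeriv_eq_iterate_pd g hg, sortedWord]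
  simp only [wordDeriv_append, wordDeriv_replicate]

/-- `mixedDeriv ν g (p 0) … (p 4) = wordDeriv (sortedWord ν) (U5 g) p`. [folklore] -/
theorem mixedDeriv_eq_wordDeriv' (g : ℝ → ℝ → ℝ → ℝ → ℝ → ℂ) (hg : ContDiff ℝ ∞ (U5 g))
    (ν : Fin 5 → ℕ) (p : R5) :
    mixedDeriv ν g (p 0) (p 1) (p 2) (p 3) (p 4) = wordDeriv (sortedWord ν) (U5 g) p := by
  rw [mixedDeriv_eq_wordDeriv g hg]
  congr 1
  funext j; fin_cases j <;> simp

/-- **`|∂^ν g| ≤ ‖D^{|ν|} (U5 g)‖`** for smooth `g`. [folklore] -/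
theorem norm_mixedDeriv_le_norm_iteratedFDeriv (g : ℝ → ℝ → ℝ → ℝ → ℝ → ℂ)
    (hg : ContDiff ℝ ∞ (U5 g)) (ν : Fin 5 → ℕ) {k : ℕ} (hk : ν 0 + ν 1 + ν 2 + ν 3 + ν 4 = k)
    (p : R5) :
    ‖mixedDeriv ν g (p 0) (p 1) (p 2) (p 3) (p 4)‖ ≤ ‖iteratedFDeriv ℝ k (U5 g) p‖ := by
  rw [mixedDeriv_eq_wordDeriv' g hg, ← hk, ← length_sortedWord]
  exact norm_wordDeriv_le_norm_iteratedFDeriv hg _ p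

/-- Conversely, word derivatives are (sorted) mixed derivatives: for every word `w`,
`wordDeriv w (U5 g) p = mixedDeriv (count w) g p`. [folklore] -/
theorem wordDeriv_U5_eq_mixedDeriv (g : ℝ → ℝ → ℝ → ℝ → ℝ → ℂ) (hg : ContDiff ℝ ∞ (U5 g))
    (w : List (Fin 5)) (p : R5) :
    wordDeriv w (U5 g) p = mixedDeriv (fun i => w.count i) g (p 0) (p 1) (p 2) (p 3) (p 4) := by
  rw [mixedDeriv_eq_wordDeriv' g hg, wordDeriv_eq_wordDeriv_sortedWord hg]

/-! ### Diagonal rescaling and locality -/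

/-- The diagonal linear map `y ↦ (a₀y₀, …, a₄y₄)`. [folklore] -/
def scale5 (a : R5) : R5 →L[ℝ] R5 :=
  ContinuousLinearMap.pi fun j => a j • ContinuousLinearMap.proj j

/-- Unfolding `scale5`. [folklore] -/
@[simp] theorem scale5_apply (a y : R5) (j : Fin 5) : scale5 a y j = a j * y j := by
  simp [scale5]

/-- `scale a eᵢ = aᵢ eᵢ`. [folklore] -/
theorem scale5_e5 (a : R5) (i : Fin 5) : scale5 a (e5 i) = a i • e5 i := by
  funext j
  rw [scale5_apply, Pi.smul_apply, smul_eq_mul, e5_apply]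
  split_ifs with h
  · subst h; ring
  · ring

/-- Chain rule for a partial derivative through the diagonal rescaling. [folklore] -/
theorem pd_comp_scale5 {H : R5 → ℂ} (hH : ContDiff ℝ ∞ H) (a : R5) (i : Fin 5) :
    pd i (fun y => H (scale5 a y)) = fun y => (a i : ℂ) * pd i H (scale5 a y) := by
  funext y
  rw [pd_apply, pd_apply]
  have hd : DifferentiableAt ℝ H (scale5 a y) := (contDiff_infty_iff_fderiv.mp hH).1 _
  rw [show (fun y => H (scale5 a y)) = H ∘ (scale5 a) from rfl,
    fderiv_comp y hd (scale5 a).differentiableAt, (scale5 a).fderiv]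
  rw [ContinuousLinearMap.comp_apply, scale5_e5, ContinuousLinearMap.map_smul]
  rw [Complex.real_smul]

/-- Rescaled smooth functions are smooth. [folklore] -/
theorem contDiff_comp_scale5 {H : R5 → ℂ} (hH : ContDiff ℝ ∞ H) (a : R5) :
    ContDiff ℝ ∞ (fun y => H (scale5 a y)) :=
  hH.comp (scale5 a).contDiff

/-- **Rescaling**: `∂_w (H ∘ scale a) = (∏_{i ∈ w} aᵢ) · (∂_w H) ∘ scale a`. [folklore] -/
theorem wordDeriv_comp_scale5 {H : R5 → ℂ} (hH : ContDiff ℝ ∞ H) (a : R5) (w : List (Fin 5)) :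
    wordDeriv w (fun y => H (scale5 a y)) =
      fun y => ((w.map fun i => (a i : ℂ)).prod) * wordDeriv w H (scale5 a y) := by
  induction w with
  | nil => funext y; simp
  | cons i w ih =>
    rw [wordDeriv_cons, ih]
    have hs : ContDiff ℝ ∞ (wordDeriv w H) := contDiff_wordDeriv hH w
    have hsc : ContDiff ℝ ∞ (fun y => wordDeriv w H (scale5 a y)) := contDiff_comp_scale5 hs a
    funext y
    rw [pd_apply]
    rw [fderiv_const_mul ((contDiff_infty_iff_fderiv.mp hsc).1 y)]
    rw [FunLike.coe_smul, Pi.smul_apply, ← pd_apply, pd_comp_scale5 hs a i]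
    simp only [List.map_cons, List.prod_cons, wordDeriv_cons, smul_eq_mul]
    ring

/-- **Locality**: if `H` vanishes near `x`, so does every word derivative. [folklore] -/
theorem wordDeriv_eventuallyEq_zero {H : R5 → ℂ} {x : R5} (h : H =ᶠ[𝓝 x] 0) (w : List (Fin 5)) :
    wordDeriv w H =ᶠ[𝓝 x] 0 := by
  induction w with
  | nil => exact h
  | cons i w ih =>
    rw [wordDeriv_cons]
    have h2 : ∀ᶠ y in 𝓝 x, wordDeriv w H =ᶠ[𝓝 y] (0 : R5 → ℂ) :=
      Filter.Eventually.eventually_nhds ih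
    filter_upwards [h2] with y hy
    rw [pd_apply, Filter.EventuallyEq.fderiv_eq hy]
    simp

/-- **Locality** (pointwise form). [folklore] -/
theorem wordDeriv_eq_zero_of_eventuallyEq {H : R5 → ℂ} {x : R5} (h : H =ᶠ[𝓝 x] 0)
    (w : List (Fin 5)) : wordDeriv w H x = 0 :=
  (wordDeriv_eventuallyEq_zero h w).self_of_nhds

end KloostermanQuintilinear

end Literature.NumberTheory.Sieve

end
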